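import Summits.AtomisticToContinuum.FouriersLaw.Theorems.ParityLiouvilleSeedLiouvilleForHeatHarmonicDefs
import Mathlib.MeasureTheory.Integral.Marginal

/-!
# The radiating Gaussian state of the harmonic chain: box insertions (definitions)

Definitions for the REGULARITY part of the harmonic tightness witness of
`ParityLiouvilleSeed.LiouvilleForHeat` (`stmt-AtomisticToContinuum-13980`): the finite-volume Gibbs
distributions of the chain in a box `Λ = {a, …, a+n}` are marginal integrals over `↥Λ → ℝ × ℝ`
(`MeasureTheory.lmarginal`, `Function.updateFinset`), while box marginals live on
`Fin (n+1) → ℝ × ℝ`; this file fixes the re-indexing.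

* `boxEquiv a n : Fin (n+1) ≃ ↥(Finset.Icc a (a+n))`, `i ↦ a + i`;
* `insBox a n η x` — the configuration equal to the box data `x` on `Λ` and to `η` off `Λ`
  (`= Function.updateFinset η Λ (x ∘ (boxEquiv a n).symm)`);
* `boxQuad c x = ∑ᵢ (p_i²/2 + c q_i²)` — the diagonal quadratic dominating the box energy of the
  harmonic chain.
-/

noncomputable section

open MeasureTheory
open Literature.MathematicalPhysics.KineticTheory.HeatConduction

namespace Summit.AtomisticToContinuum.FouriersLaw.Theorems.ParityLiouvilleSeed.HarmonicWitness

/-- The enumeration `i ↦ a + i` of the box `{a, …, a+n}`. [folklore] -/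
def boxEquiv (a : ℤ) (n : ℕ) : Fin (n + 1) ≃ ↥(Finset.Icc a (a + n)) where
  toFun i := ⟨a + i, by simp only [Finset.mem_Icc]; omega⟩
  invFun z := ⟨(z.1 - a).toNat, by have := Finset.mem_Icc.mp z.2; omega⟩
  left_inv i := by
    ext
    simp
  right_inv z := by
    have := Finset.mem_Icc.mp z.2
    apply Subtype.ext
    simp only
    omega

/-- **Insertion of box data into a boundary condition**: the configuration equal to `x` (re-indexed by
`boxEquiv`) on `Λ = {a, …, a+n}` and to `η` off `Λ`. [folklore] -/
def insBox (a : ℤ) (n : ℕ) (η : ChainConfig) (x : Fin (n + 1) → ℝ × ℝ) : ChainConfig :=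
  Function.updateFinset η (Finset.Icc a (a + n)) fun z => x ((boxEquiv a n).symm z)

/-- The diagonal quadratic `∑ᵢ (p_i²/2 + c q_i²)` on box data. [folklore] -/
def boxQuad {n : ℕ} (c : ℝ) (x : Fin (n + 1) → ℝ × ℝ) : ℝ := ∑ i, ((x i).2 ^ 2 / 2 + c * (x i).1 ^ 2)

/-! ### Immediate API -/

/-- [folklore] -/
@[simp] theorem boxEquiv_apply_coe (a : ℤ) (n : ℕ) (i : Fin (n + 1)) : ((boxEquiv a n i : ↥(Finset.Icc a (a + n))) : ℤ) = a + i :=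
  rfl

/-- [folklore] -/
@[simp] theorem boxEquiv_symm_apply_val (a : ℤ) (n : ℕ) (z : ↥(Finset.Icc a (a + n))) :
    ((boxEquiv a n).symm z).val = (z.1 - a).toNat := rfl

/-- Values of the insertion on the box. [folklore] -/
theorem insBox_apply_of_mem (a : ℤ) (n : ℕ) (η : ChainConfig) (x : Fin (n + 1) → ℝ × ℝ) (z : ℤ)
    (hz : z ∈ Finset.Icc a (a + n)) : insBox a n η x z = x ((boxEquiv a n).symm ⟨z, hz⟩) := by
  simp only [insBox, Function.updateFinset, dif_pos hz]

/-- Values of the insertion off the box. [folklore] -/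
theorem insBox_apply_of_not_mem (a : ℤ) (n : ℕ) (η : ChainConfig) (x : Fin (n + 1) → ℝ × ℝ) (z : ℤ)
    (hz : z ∉ Finset.Icc a (a + n)) : insBox a n η x z = η z := by
  simp only [insBox, Function.updateFinset, dif_neg hz]

/-- Values of the insertion at the enumerated box sites. [folklore] -/
@[simp] theorem insBox_apply_box (a : ℤ) (n : ℕ) (η : ChainConfig) (x : Fin (n + 1) → ℝ × ℝ) (i : Fin (n + 1)) :
    insBox a n η x (a + i) = x i := by
  have h : (a + i : ℤ) ∈ Finset.Icc a (a + n) := (boxEquiv a n i).2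
  rw [insBox_apply_of_mem a n η x _ h]
  congr 1
  exact (boxEquiv a n).symm_apply_apply i

/-- The box restriction of an insertion is the inserted data. [folklore] -/
@[simp] theorem boxRestrictAt_insBox (a : ℤ) (n : ℕ) (η : ChainConfig) (x : Fin (n + 1) → ℝ × ℝ) :
    boxRestrictAt a n (insBox a n η x) = x := by
  funext i
  rw [boxRestrictAt_apply, insBox_apply_box]

/-- The insertion depends measurably on the box data. [folklore] -/
@[fun_prop]
theorem measurable_insBox (a : ℤ) (n : ℕ) (η : ChainConfig) : Measurable (insBox a n η) := by
  unfold insBox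
  exact measurable_updateFinset.comp (measurable_pi_lambda _ fun z => measurable_pi_apply _)

/-- The insertion is jointly measurable in the boundary condition and the box data. [folklore] -/
theorem measurable_insBox_uncurry (a : ℤ) (n : ℕ) :
    Measurable fun p : ChainConfig × (Fin (n + 1) → ℝ × ℝ) => insBox a n p.1 p.2 := by
  refine measurable_pi_lambda _ fun z => ?_
  by_cases hz : z ∈ Finset.Icc a (a + n)
  · simp only [insBox_apply_of_mem a n _ _ z hz]
    exact (measurable_pi_apply _).comp measurable_snd
  · simp only [insBox_apply_of_not_mem a n _ _ z hz]
    exact (measurable_pi_apply _).comp measurable_fst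

/-- The quadratic is continuous. [folklore] -/
@[fun_prop]
theorem continuous_boxQuad {n : ℕ} (c : ℝ) : Continuous (boxQuad (n := n) c) := by
  unfold boxQuad
  fun_prop

/-- The quadratic is non-negative for `c ≥ 0`. [folklore] -/
theorem boxQuad_nonneg {n : ℕ} {c : ℝ} (hc : 0 ≤ c) (x : Fin (n + 1) → ℝ × ℝ) : 0 ≤ boxQuad c x :=
  Finset.sum_nonneg fun i _ => by positivity

end Summit.AtomisticToContinuum.FouriersLaw.Theorems.ParityLiouvilleSeed.HarmonicWitness

end
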